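import Summits.MatrixMultiplication.OmegaCensus.STPPVosperSlackTwoTablesZ59
import Summits.MatrixMultiplication.OmegaCensus.STPPVosperTilingWordsPruned
import Summits.MatrixMultiplication.OmegaCensus.STPPVosperSlackTwoLawABQ

/-!
# ω-census (abelian STPP census): ℤ₅₉ leaf L2 — dead-table rows for case C (`tblZ59L2C`), part 3 of 5 (kernel computations)

HONEST FRAMING (pub-omega census; verbatim): lottery ticket; floor = certified bounds/negative ranges.
Census STRUCTURE (seat pub-omega-stpp-2 gen 27 — rows service for the stpp-1 lineage's law, 2026-08-29), family (b2).  For each entry `e = (Yo, Zo)` of stpp-1 g33's dead table `tblZ59L2C` (`STPPVosperSlackTwoTablesZ59.lean`, 30 entries) the words-cover search over the two other blocks returns `false` (SWAPPED orientation, WP, blocks (2,3,2),(3,2,4); ≤ 115k mirror steps each; soundness via `existsCoverW_both_of_isSTPP_enum`).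
Each theorem is ONE `decide +kernel` over a range of table entries.  Assembly in `STPPVosperSlackTwoRows59L2TblCAsm.lean`.  Nothing here is progress on `ω`.
-/

namespace Summit.MatrixMultiplication.OmegaCensus.CubeNB.S2

open Summit.MatrixMultiplication.OmegaCensus.CubeNB

/-- Dead-table entries `[12, 13)` of `tblZ59L2C`: the words-cover search fails. [folklore] -/
theorem dead59L2C_c12 : ∀ e ∈ (tblZ59L2C.drop 12).take 1, existsCoverW 59 e.2 e.1 [blockDiffsWP 59 e.2 e.1 2 3 2, blockDiffsWP 59 e.2 e.1 3 2 4] [] [] [] = false := by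
  decide +kernel

/-- Dead-table entries `[13, 14)` of `tblZ59L2C`: the words-cover search fails. [folklore] -/
theorem dead59L2C_c13 : ∀ e ∈ (tblZ59L2C.drop 13).take 1, existsCoverW 59 e.2 e.1 [blockDiffsWP 59 e.2 e.1 2 3 2, blockDiffsWP 59 e.2 e.1 3 2 4] [] [] [] = false := by
  decide +kernel

/-- Dead-table entries `[14, 15)` of `tblZ59L2C`: the words-cover search fails. [folklore] -/
theorem dead59L2C_c14 : ∀ e ∈ (tblZ59L2C.drop 14).take 1, existsCoverW 59 e.2 e.1 [blockDiffsWP 59 e.2 e.1 2 3 2, blockDiffsWP 59 e.2 e.1 3 2 4] [] [] [] = false := by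
  decide +kernel

/-- Dead-table entries `[15, 16)` of `tblZ59L2C`: the words-cover search fails. [folklore] -/
theorem dead59L2C_c15 : ∀ e ∈ (tblZ59L2C.drop 15).take 1, existsCoverW 59 e.2 e.1 [blockDiffsWP 59 e.2 e.1 2 3 2, blockDiffsWP 59 e.2 e.1 3 2 4] [] [] [] = false := by
  decide +kernel

/-- Dead-table entries `[16, 17)` of `tblZ59L2C`: the words-cover search fails. [folklore] -/
theorem dead59L2C_c16 : ∀ e ∈ (tblZ59L2C.drop 16).take 1, existsCoverW 59 e.2 e.1 [blockDiffsWP 59 e.2 e.1 2 3 2, blockDiffsWP 59 e.2 e.1 3 2 4] [] [] [] = false := by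
  decide +kernel

/-- Dead-table entries `[17, 18)` of `tblZ59L2C`: the words-cover search fails. [folklore] -/
theorem dead59L2C_c17 : ∀ e ∈ (tblZ59L2C.drop 17).take 1, existsCoverW 59 e.2 e.1 [blockDiffsWP 59 e.2 e.1 2 3 2, blockDiffsWP 59 e.2 e.1 3 2 4] [] [] [] = false := by
  decide +kernel

end Summit.MatrixMultiplication.OmegaCensus.CubeNB.S2
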